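import Summits.CriticalPhenomena.PercolationContinuityZ3.Theorems.PercNearOneGluingNoHeavyLowerTailSahiE3DnfTwoCertMain
import Summits.CriticalPhenomena.PercolationContinuityZ3.Theorems.PercNearOneGluingNoHeavyLowerTailSahiE3LroCube
import Mathlib.Logic.Equiv.Prod
import Mathlib.Algebra.BigOperators.Group.Finset.Basic
import Mathlib.Tactic.Linarith
import Mathlib.Tactic.Positivity
import HarnessLib
import HarnessLib.Audit

/-!
# `NoHeavyLowerTail` (crux stmt-CriticalPhenomena-4575), Sahi programme P4: SAHI'S `C₃` / KAHN'S CONJECTURE 5 FOR THE FIRST SLOT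
# `(x₁∧…∧x_a) ∨ (y₁∧…∧y_b)` — the union of two principal up-sets with disjoint supports

Support file (cell `prim-l12`, seat P4, generation 12; `--supports stmt-CriticalPhenomena-4575`).  No named facts, no sorries;
standard axioms; def-free.

`cert_dnf_two_cube`: the explicit certificate of `…SahiE3DnfTwoCertMain.cert_dnf_two` transported to the pattern cube
`Fin (a+1) ⊕ Fin (b+1) → Bool` with a strictly positive product weight (Harris on the blocks from `…SahiE3LroSlot.cert_lro`,
transport `…SahiE3LroTransport.cert_transport` along `Equiv.sumArrowEquivProdArrow`).
`latticeE3_nonneg_of_dnf_two`: hence, by the kernel theorem `…SahiE3PatternCertificate.latticeE3_nonneg_of_patternCertificate`,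
`0 ≤ latticeE3 μ U A B` on every finite distributive lattice with log-supermodular `μ ≥ 0`, join-primes `j`, up-sets `A, B`, for the slot
`U = {x | (∀ k, j (inl k) ≤ x) ∨ (∀ k, j (inr k) ≤ x)}` whenever the pattern marginal is a strictly positive product weight.
`latticeE3_nonneg_dnf_two_prod`: the Boolean form — `μ(ω) = ∏_{u∈ω} θ_u` with `θ > 0` on `2^κ`, distinct generators
`v : Fin (a+1) ⊕ Fin (b+1) → κ`, first slot `{ω | (∀ k, v (inl k) ∈ ω) ∨ (∀ k, v (inr k) ∈ ω)}`, `A, B` arbitrary up-sets.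
This is the first slot class with an OR of two COMPOUND read-once blocks (beyond the linear read-once slots of generation 11);
the corresponding AND-composition is obstructed (`…SahiE3CertificateObstructionCNF`).  HOME prim-l12-p4/FROM-prim-l12-p4-gen12-*.md §5.
-/

namespace Summit.CriticalPhenomena.PercolationContinuityZ3.Theorems.SahiE3DnfTwoSlot

open Finset SahiE3DnfTwoCertMain SahiE3LroTransport
open scoped BigOperators

/-- **The certificate of `(x₁∧…∧x_a) ∨ (y₁∧…∧y_b)` on the pattern cube** `Fin (a+1) ⊕ Fin (b+1) → Bool` with a strictly positive
product weight `ν(t) = ∏ᵢ wᵢ(tᵢ)`: the slot `U = {t | (∀ k, t (inl k)) ∨ (∀ k, t (inr k))}` is an up-set and carries a flow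
certificate with exact deliveries. [this work] -/
theorem cert_dnf_two_cube (a b : ℕ) (w : Fin (a + 1) ⊕ Fin (b + 1) → Bool → ℝ) (hw : ∀ i c, 0 < w i c)
    (ν : (Fin (a + 1) ⊕ Fin (b + 1) → Bool) → ℝ) (hν : ∀ t, ν t = ∏ i, w i (t i))
    (U : Finset (Fin (a + 1) ⊕ Fin (b + 1) → Bool))
    (hU : ∀ t, t ∈ U ↔ ((∀ k, t (Sum.inl k) = true) ∨ (∀ k, t (Sum.inr k) = true))) :
    IsUpperSet (U : Set (Fin (a + 1) ⊕ Fin (b + 1) → Bool)) ∧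
    ∃ (R : (Fin (a + 1) ⊕ Fin (b + 1) → Bool) → ℝ)
      (Fl : (Fin (a + 1) ⊕ Fin (b + 1) → Bool) → (Fin (a + 1) ⊕ Fin (b + 1) → Bool) → ℝ),
      (∀ t ∈ U, 0 ≤ R t) ∧ (∀ t s, 0 ≤ Fl t s) ∧ (∀ t s, Fl t s ≠ 0 → s ≤ t) ∧
      (∀ t ∈ U, R t + ∑ s ∈ Uᶜ, Fl t s ≤ (∑ r, ν r) * ((∑ r, ν r) + ∑ r ∈ Uᶜ, ν r) * ν t) ∧
      (∀ s ∈ Uᶜ, ∑ t ∈ U, Fl t s = (∑ r, ν r) * (∑ r ∈ U, ν r) * ν s) ∧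
      (∀ S S' : Finset (Fin (a + 1) ⊕ Fin (b + 1) → Bool), IsUpperSet (S : Set (Fin (a + 1) ⊕ Fin (b + 1) → Bool)) →
        IsUpperSet (S' : Set (Fin (a + 1) ⊕ Fin (b + 1) → Bool)) →
        (∑ r, ν r) * ((∑ t ∈ S, ν t) * (∑ t ∈ S' ∩ U, ν t) + (∑ t ∈ S', ν t) * (∑ t ∈ S ∩ U, ν t))
            - (∑ r ∈ U, ν r) * (∑ t ∈ S, ν t) * (∑ t ∈ S', ν t) ≤ ∑ t ∈ (S ∩ S') ∩ U, R t) := by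
  refine ⟨?_, ?_⟩
  · intro x y hxy hx
    simp only [Finset.mem_coe, hU] at hx ⊢
    rcases hx with h | h
    · exact Or.inl fun k => top_le_iff.mp (le_trans (h k).ge (hxy (Sum.inl k)))
    · exact Or.inr fun k => top_le_iff.mp (le_trans (h k).ge (hxy (Sum.inr k)))
  -- block weights and Harris on the blocks (from the linear read-once file)
  set νA : (Fin (a + 1) → Bool) → ℝ := fun s => ∏ k, w (Sum.inl k) (s k) with hνA
  set νB : (Fin (b + 1) → Bool) → ℝ := fun s => ∏ k, w (Sum.inr k) (s k) with hνB
  have hwA : ∀ k c, 0 ≤ w (Sum.inl k) c := fun k c => (hw _ _).le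
  have hwB : ∀ k c, 0 ≤ w (Sum.inr k) c := fun k c => (hw _ _).le
  have hνA0 : ∀ s, 0 ≤ νA s := fun s => Finset.prod_nonneg fun k _ => hwA _ _
  have hνB0 : ∀ s, 0 ≤ νB s := fun s => Finset.prod_nonneg fun k _ => hwB _ _
  have hνApos : ∀ s, 0 < νA s := fun s => Finset.prod_pos fun k _ => hw _ _
  have hνBpos : ∀ s, 0 < νB s := fun s => Finset.prod_pos fun k _ => hw _ _
  obtain ⟨UA, hUA⟩ : ∃ V : Finset (Fin (a + 1) → Bool), ∀ x, x ∈ V ↔ Fin.foldr a (fun i c => bif (fun _ => true) i then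
      (x i.castSucc || c) else (x i.castSucc && c)) (x (Fin.last a)) = true :=
    ⟨univ.filter fun x => Fin.foldr a (fun i c => bif (fun _ => true) i then (x i.castSucc || c) else (x i.castSucc && c))
      (x (Fin.last a)) = true, fun x => by simp⟩
  obtain ⟨UB, hUB⟩ : ∃ V : Finset (Fin (b + 1) → Bool), ∀ x, x ∈ V ↔ Fin.foldr b (fun i c => bif (fun _ => true) i then
      (x i.castSucc || c) else (x i.castSucc && c)) (x (Fin.last b)) = true :=
    ⟨univ.filter fun x => Fin.foldr b (fun i c => bif (fun _ => true) i then (x i.castSucc || c) else (x i.castSucc && c))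
      (x (Fin.last b)) = true, fun x => by simp⟩
  have hHA := (SahiE3LroSlot.cert_lro a (fun _ => true) (fun k => w (Sum.inl k)) hwA νA (fun _ => rfl) UA hUA).2.1
  have hHB := (SahiE3LroSlot.cert_lro b (fun _ => true) (fun k => w (Sum.inr k)) hwB νB (fun _ => rfl) UB hUB).2.1
  -- tops, the positivity of `Δ'`
  have htA : ∀ s : Fin (a + 1) → Bool, s ≤ fun _ => true := fun s k => Bool.le_true _
  have htB : ∀ s : Fin (b + 1) → Bool, s ≤ fun _ => true := fun s k => Bool.le_true _
  have hΔ : 0 < νA (fun _ => true) * (∑ s ∈ univ.filter (fun s => s ≠ fun _ => true), νB s)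
      + (∑ s ∈ univ.filter (fun s => s ≠ fun _ => true), νA s) * νB (fun _ => true) := by
    have hne : (fun _ : Fin (a + 1) => false) ∈ univ.filter (fun s : Fin (a + 1) → Bool => s ≠ fun _ => true) := by
      simp only [Finset.mem_filter, Finset.mem_univ, true_and, ne_eq, funext_iff, not_forall]
      exact ⟨0, by simp⟩
    have hQA : 0 < ∑ s ∈ univ.filter (fun s : Fin (a + 1) → Bool => s ≠ fun _ => true), νA s :=
      lt_of_lt_of_le (hνApos _) (Finset.single_le_sum (fun s _ => hνA0 s) hne)
    have hQB : 0 ≤ ∑ s ∈ univ.filter (fun s : Fin (b + 1) → Bool => s ≠ fun _ => true), νB s :=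
      Finset.sum_nonneg fun s _ => hνB0 s
    nlinarith [mul_pos hQA (hνBpos fun _ => true), mul_nonneg (hνA0 fun _ => true) hQB]
  -- the certificate on the product of the blocks
  obtain ⟨Up, hUp⟩ : ∃ V : Finset ((Fin (a + 1) → Bool) × (Fin (b + 1) → Bool)),
      ∀ x, x ∈ V ↔ (x.1 = (fun _ => true) ∨ x.2 = (fun _ => true)) :=
    ⟨univ.filter fun x => x.1 = (fun _ => true) ∨ x.2 = (fun _ => true), fun x => by simp⟩
  obtain ⟨R, Fl, c1, c2, c3, c4, c5, c6⟩ := cert_dnf_two hνA0 hνB0 (fun _ => true) htA (fun _ => true) htB hHA hHB hΔ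
    (fun x => νA x.1 * νB x.2) (fun _ => rfl) Up hUp
  -- transport along `(Fin (a+1) → Bool) × (Fin (b+1) → Bool) ≃o (Fin (a+1) ⊕ Fin (b+1) → Bool)`
  let e : ((Fin (a + 1) → Bool) × (Fin (b + 1) → Bool)) ≃o (Fin (a + 1) ⊕ Fin (b + 1) → Bool) :=
    { toEquiv := (Equiv.sumArrowEquivProdArrow (Fin (a + 1)) (Fin (b + 1)) Bool).symm
      map_rel_iff' := by
        rintro ⟨p1, p2⟩ ⟨q1, q2⟩
        simp only [Equiv.sumArrowEquivProdArrow, Equiv.coe_fn_symm_mk, Pi.le_def, Prod.mk_le_mk, Sum.forall,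
          Sum.elim_inl, Sum.elim_inr] }
  have hes : ∀ y : Fin (a + 1) ⊕ Fin (b + 1) → Bool,
      e.symm y = (fun k => y (Sum.inl k), fun k => y (Sum.inr k)) := fun y => rfl
  have hνe : ∀ y, ν y = (fun x : (Fin (a + 1) → Bool) × (Fin (b + 1) → Bool) => νA x.1 * νB x.2) (e.symm y) := by
    intro y
    rw [hes, hν, Fintype.prod_sum_type]
  have hUe : ∀ y, y ∈ U ↔ e.symm y ∈ Up := by
    intro y
    rw [hes, hU, hUp]
    simp only [funext_iff]
  exact cert_transport e c1 c2 c3 c4 c5 c6 ν hνe U hUe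

/-! ### The lattice theorem and the Boolean form -/

section Lattice

open Literature.Probability.LatticeModels

variable {α : Type*} [DistribLattice α] [Fintype α] [DecidableEq α] [DecidableLE α]

open scoped Classical in
/-- **Sahi's `C₃` / Kahn's Conjecture 5 for the union of two principal up-sets on disjoint join-prime blocks.**
`L` finite distributive, `μ ≥ 0` log-supermodular, `j : Fin (a+1) ⊕ Fin (b+1) → L` join-primes, `A, B` up-sets, slot
`U = {x | (∀ k, j (inl k) ≤ x) ∨ (∀ k, j (inr k) ≤ x)}`.  If the pattern marginal `t ↦ m{x | (j i ≤ x)ᵢ = t}` is a strictly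
positive product weight `∏ᵢ wᵢ(tᵢ)`, then `0 ≤ latticeE3 μ U A B`. [this work] -/
theorem latticeE3_nonneg_of_dnf_two {μ : α → ℝ} (hμ₀ : 0 ≤ μ)
    (hμ : ∀ x y, μ x * μ y ≤ μ (x ⊓ y) * μ (x ⊔ y)) (a b : ℕ) {j : Fin (a + 1) ⊕ Fin (b + 1) → α}
    (hj : ∀ i, SupPrime (j i)) {F : (Fin (a + 1) ⊕ Fin (b + 1) → Bool) → Finset α}
    (hF : ∀ (t : Fin (a + 1) ⊕ Fin (b + 1) → Bool) (x : α), x ∈ F t ↔ ∀ i, (j i ≤ x ↔ t i = true))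
    {A B : Finset α} (hA : IsUpperSet (A : Set α)) (hB : IsUpperSet (B : Set α))
    (w : Fin (a + 1) ⊕ Fin (b + 1) → Bool → ℝ) (hw : ∀ i c, 0 < w i c) (hν : ∀ t, mass μ (F t) = ∏ i, w i (t i))
    (U' : Finset (Fin (a + 1) ⊕ Fin (b + 1) → Bool))
    (hU' : ∀ t, t ∈ U' ↔ ((∀ k, t (Sum.inl k) = true) ∨ (∀ k, t (Sum.inr k) = true))) :
    0 ≤ latticeE3 μ (univ.filter fun x => (fun i => decide (j i ≤ x)) ∈ U') A B := by
  obtain ⟨-, R, Fl, h1, h2, h3, h4, h5, h6⟩ :=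
    cert_dnf_two_cube a b w hw (fun t => ∏ i, w i (t i)) (fun _ => rfl) U' hU'
  refine SahiE3PatternCertificate.latticeE3_nonneg_of_patternCertificate hμ₀ hμ hj hF hA hB U'
    (fun t => ∏ i, w i (t i)) (fun t => (hν t).symm) R Fl h1 h2 h3 h4 (fun s hs => (h5 s hs).ge) ?_
  intro S S' hS hS'
  have hz : ∑ s ∈ (S ∩ S') ∩ U'ᶜ, (∑ t ∈ U', Fl t s - (∑ r : Fin (a + 1) ⊕ Fin (b + 1) → Bool, ∏ i, w i (r i)) *
      (∑ r ∈ U', ∏ i, w i (r i)) * ∏ i, w i (s i)) = 0 :=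
    Finset.sum_eq_zero fun s hs => by rw [h5 s (Finset.mem_inter.1 hs).2, sub_self]
  rw [hz, add_zero]
  exact h6 S S' hS hS'

end Lattice

section Cube

open Literature.Probability.LatticeModels

variable {κ : Type*} [Fintype κ] [DecidableEq κ]

/-- **Kahn's Conjecture 5 for the first slot `(x₁∧…∧x_a) ∨ (y₁∧…∧y_b)`, product weights on `2^κ`.**  `μ(ω) = ∏_{u∈ω} θ_u`
with `θ > 0`, distinct generators `v : Fin (a+1) ⊕ Fin (b+1) → κ`, `A, B` arbitrary up-sets:
`0 ≤ latticeE3 μ {ω | (∀ k, v (inl k) ∈ ω) ∨ (∀ k, v (inr k) ∈ ω)} A B`. [this work] -/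
theorem latticeE3_nonneg_dnf_two_prod {θ : κ → ℝ} (hθ : ∀ u, 0 < θ u) (a b : ℕ)
    {v : Fin (a + 1) ⊕ Fin (b + 1) → κ} (hv : Function.Injective v) {A B : Finset (Finset κ)}
    (hA : IsUpperSet (A : Set (Finset κ))) (hB : IsUpperSet (B : Set (Finset κ))) :
    0 ≤ latticeE3 (fun ω : Finset κ => ∏ u ∈ ω, θ u)
      (univ.filter fun ω : Finset κ => (∀ k, v (Sum.inl k) ∈ ω) ∨ (∀ k, v (Sum.inr k) ∈ ω)) A B := by
  classical
  have hθ0 : ∀ u, 0 ≤ θ u := fun u => (hθ u).le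
  set F : (Fin (a + 1) ⊕ Fin (b + 1) → Bool) → Finset (Finset κ) :=
    fun t => univ.filter fun ω : Finset κ => ∀ l, (v l ∈ ω ↔ t l = true) with hFdef
  have hF : ∀ (t : Fin (a + 1) ⊕ Fin (b + 1) → Bool) (ω : Finset κ), ω ∈ F t ↔ ∀ l, (v l ∈ ω ↔ t l = true) := by
    intro t ω; simp [hFdef]
  have hF' : ∀ (t : Fin (a + 1) ⊕ Fin (b + 1) → Bool) (ω : Finset κ),
      ω ∈ F t ↔ ∀ l, (({v l} : Finset κ) ≤ ω ↔ t l = true) := by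
    intro t ω; rw [hF]; simp
  set C : ℝ := ∑ ω ∈ ((univ : Finset (Fin (a + 1) ⊕ Fin (b + 1))).image v)ᶜ.powerset, ∏ u ∈ ω, θ u with hC
  have hCpos : 0 < C := by
    have h1 : (1 : ℝ) ≤ C := by
      have hmem : (∅ : Finset κ) ∈ ((univ : Finset (Fin (a + 1) ⊕ Fin (b + 1))).image v)ᶜ.powerset := by simp
      have := Finset.single_le_sum (f := fun ω : Finset κ => ∏ u ∈ ω, θ u)
        (fun ω _ => Finset.prod_nonneg fun u _ => hθ0 u) hmem
      simpa using this
    linarith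
  set w : Fin (a + 1) ⊕ Fin (b + 1) → Bool → ℝ :=
    fun i c => (if c = true then θ (v i) else 1) * (if i = Sum.inl 0 then C else 1) with hw
  have hwpos : ∀ i c, 0 < w i c := by
    intro i c; simp only [hw]
    have := hθ (v i)
    split_ifs <;> positivity
  have hν : ∀ t, mass (fun ω : Finset κ => ∏ u ∈ ω, θ u) (F t) = ∏ i, w i (t i) := by
    intro t
    rw [SahiE3LroCube.mass_fib_prod θ hv hF t, ← hC, hw, Finset.prod_mul_distrib,
      Finset.prod_ite_eq' univ (Sum.inl 0 : Fin (a + 1) ⊕ Fin (b + 1))]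
    simp
  obtain ⟨U', hU'⟩ : ∃ V : Finset (Fin (a + 1) ⊕ Fin (b + 1) → Bool),
      ∀ t, t ∈ V ↔ ((∀ k, t (Sum.inl k) = true) ∨ (∀ k, t (Sum.inr k) = true)) :=
    ⟨univ.filter fun t => (∀ k, t (Sum.inl k) = true) ∨ (∀ k, t (Sum.inr k) = true), fun t => by simp⟩
  have key := latticeE3_nonneg_of_dnf_two (SahiE3HitSlotProduct.prod_nonneg' hθ0) (SahiE3HitSlotProduct.prod_lsm θ) a b
    (fun i => SahiE3CovHit.supPrime_singleton' (v i)) hF' hA hB w hwpos hν U' hU'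
  have hslot : (univ.filter fun ω : Finset κ => (fun i => decide (({v i} : Finset κ) ≤ ω)) ∈ U') =
      univ.filter fun ω : Finset κ => (∀ k, v (Sum.inl k) ∈ ω) ∨ (∀ k, v (Sum.inr k) ∈ ω) := by
    congr 1; ext ω; simp [hU']
  rw [hslot] at key
  exact key

end Cube

end Summit.CriticalPhenomena.PercolationContinuityZ3.Theorems.SahiE3DnfTwoSlot
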